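/-
Copyright: statement-level skeleton of a published paper (lit-balaban cell, Phase-2 proof seat p25, gen 19). No proof
claims beyond what the kernel checks below.
-/
import Literature.MathematicalPhysics.QuantumFieldTheory.BalabanImbrieJaffe1984to88.BIJ88WalkRemainderSmall312
import Literature.MathematicalPhysics.QuantumFieldTheory.BalabanImbrieJaffe1984to88.BIJ88WalkRemainderFieldLaw312

/-!
# `BalabanImbrieJaffe1984to88.BIJ88WalkRemainderActivity312` — T. Bałaban, J. Imbrie, A. Jaffe, *Effective action and
cluster properties of the abelian Higgs model*, Commun. Math. Phys. **114** (1988) 257–315 [BalabanImbrieJaffe1988],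
§5.14 p. 312 [PDF 56], verbatim: *"Summing all terms in X_r gives an observable F_{k,rem}(X_r). Then the result of the
integration by parts is z_F/Z = ⟨Π_{σ_1} F^{m̄}_{k,loc}(X_{σ_1})⟩_1 = Σ_{{X_r}} Π_c F^L_{k+1,loc}(X_c) ⟨Π_r F_{k,rem}(X_r)⟩_1"*
(first display), *"The X_{r′} are disjoint, and each one covers at least one X_{σ_1}, the support of one of the
observables F^{m̄}_{k,loc}."*, *"These considerations lead to the following estimate:
|G_k(X)| ≤ c(F(X))(e^β(L^kε/ε₀)^{1/4−α})^{β′|X∖∪X_c|} Π [c(L^kε)^{−m(c)}e^{−m′(c)}]"* — **THE REMAINDER PART LOCALIZED AT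
THE FAMILY OF ITS REMAINDER COMPONENTS, BOUNDED ON THE LAW WITH ALL THE SMALL FACTORS** (p25 gen 19; v1.1 docfix r16
v2.272: quotations aligned with the x2 render `lit-balaban-r16/renders/cmp114/original-p056-x2.png` — «V^{(k)}(Y)'s»,
«X_{σ_1}», «F^{m̄}_{k,loc}», the first display with «z_F/Z» and «⟨·⟩_1»; declarations untouched): the remainder part
`remv` of the covariance-split expansion (`BIJ88WalkResummation312`) is split according to the LOCATED family
`{(observables of X_r, cubes of X_r)}_r` of the remainder components of each term (`rloc`, `remAt`,
`sum_remAt_eq_remv`) — print's `⟨Π_r F_{k,rem}(X_r)⟩` indexed by `{X_r}`, each `X_r` carrying its observables; on the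
§5.13 model of record, if every remainder term's normalized expectation is at most `K_χ·Λ·Π_{z∈dirs}(η_χ‖z‖)` (the
cutoff's derivatives cost `η_χ` each, the moments `Λ`), then
`|remAt(O,{X_r})/Z| ≤ K_χ·Λ·W^{Φ₀(O)}·(Π_{j∈O} B_ℓ^{|obs j|})·θ^{Σ_r #(X_r ∖ obs cubes)}·s^{#{X_r}}` (`abs_remAt_div_le`):
the printed large constant per observable, small factor per uncovered cube, `c(F)`, AND one extra small factor
`s = max(η_χ, θ_v^M, θ_w)` per remainder component — and the located families are summable against the inverse of
all the small factors (`sum_abs_remAt_div_weighted_le`), uniformly in the volume.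

statement-level skeleton of published theorems with citation tags; proofs where landed; nothing here is a claim
about the Yang–Mills mass gap

PDF held: `paper:balaban1988-cmp114-bij-abelian-higgs-effective-action` (journal page = PDF page + 256); p. 312 =
PDF 56 (`p0056.txt` L5–9, L18–19, L27–29 re-read this session, 2026-08-23).

CITATION HEADER (lean-in-tree rule).  lit-balaban cell (HOME `run/shared/lean/pub/lit-balaban/`), Phase 2, seat p25
gen 19; row **C2.Claim@312** of `HOME/lit-balaban-r16/ROWS-C2-part2.md` (owner r16, referee ref-5; head
`BIJ88Sect5StatementsPart4.Ineq312` untouched — MEMBER of the row).  USED BY NAME, nothing restated: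
`BIJ88WalkRemainderSmall312.expand_l1_small_free_le`, `BIJ88WalkRemainderShape312` (p25 gen 19),
`BIJ88WalkResummation312.remv`, `BIJ88WalkIdentity311.tval`, `BIJ88WalkExpansion311.{expand, WTerm}`,
`BIJ88WalkGeometry311.cubes`, `BIJ88Resummation312.{sum_map_ite, sum_map_finset_sum_comm}`,
`BIJ88LabelledRemainderFieldLaw312.gintM_eq_mul_integral_fieldLaw` (p25 gen 17–18), the §5.13 model
`BIJ88PolymerRep5134Gauss.{prec, src}`, `BIJ88SlotMomentsGauss308.{fieldLaw, integral_density_pos}` (p36, r-seats).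

## What is proved (0 `sorry`, standard axioms, no new `Prop` facts; definitions with bodies: `rloc`, `nfreeOf`, `remAt`)

* §1 `rloc` (the located family of a term's remainder components), `nfreeOf` (its uncovered cubes), `card_rloc`,
  `nfreeOf_rloc`, `remAt` (the remainder part localized at a located family), **`sum_remAt_eq_remv`**.
* §2 (the §5.13 law) `prod_map_const_mul'`, **`remAt_div_eq_sum_fieldLaw`**, **`sum_abs_remAt_div_weighted_le`**,
  **`abs_remAt_div_le`**.
HONEST SCOPE: (a) the expectation bound `K_χ·Λ·Π(η_χ‖z‖)` per remainder term is a HYPOTHESIS (moments of the pending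
legs and the cutoff's derivatives on the law; print's p. 309 mechanism — the shell probability — is in gen 17–18's
`abs_remTerm_le_shell`, not inserted here); (b) `⟨Π_r F_{k,rem}(X_r)⟩` is localized at the family `{X_r}` BEFORE
print's final cluster expansion *"Mayer-expanding V^{(k)}(Y)'s and interpolating the Gaussian measure. Finally the
polymer expansion u = 1 + a permits us to factor out the normalization."* that would factor it into `Π G_k(X_{r′})` —
not done here; (c) locality abstract, `W^{Φ₀(O)}` for `c(F)`; (d) contraction-graph components;
(e) no `Ineq312` binder in this file.  NOT summit progress; NOT continuum; NOT Clay.  Imports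
`BIJ88WalkRemainderSmall312`, `BIJ88WalkRemainderFieldLaw312`; modifies nothing.
-/

noncomputable section

namespace Literature.MathematicalPhysics.QuantumFieldTheory.BalabanImbrieJaffe1984to88.BIJ88WalkRemainderActivity312

open Classical MeasureTheory Matrix Finset
open scoped BigOperators
open Literature.MathematicalPhysics.QuantumFieldTheory.Balaban1983to89
open B2Eq228Conditioning (weight source)
open BIJ88PolymerRep5134 (corner)
open BIJ88PolymerRep5134Gauss (prec src)
open BIJ88SlotMomentsGauss308 (fieldLaw integral_density_pos)
open BIJ88VertexIbp311 (vexp)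
open BIJ88WickDerivatives305 (dlist)
open BIJ88VertexComponents311 (maxArity)
open BIJ88Resummation312 (sum_map_ite sum_map_finset_sum_comm)
open BIJ88LabelledRemainderFieldLaw312 (gintM_eq_mul_integral_fieldLaw)
open BIJ88WalkRun311 BIJ88WalkGeometry311 BIJ88WalkExpansion311 BIJ88WalkIdentity311 BIJ88WalkActivityShape312
  BIJ88WalkResummation312 BIJ88WalkRemainderShape312 BIJ88WalkRemainderSmall312

variable {S : Type} [Fintype S] {ι : Type} [Fintype ι] {κ : Type} [LinearOrder κ] {P : Type} [Fintype P]
  {β : Type} [DecidableEq β]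

/-! ## §1  The remainder part localized at the located family of its remainder components -/

section Defs

variable (A : Matrix S S ℝ) (Cov : P → Matrix S S ℝ) (trig : P → Bool) (f : S → ℝ) (c : ι → ℝ)
  (legs : ι → List (S → ℝ)) (obs : κ → List (S → ℝ)) (M : ℕ) (χ : (S → ℝ) → ℝ)
  (oc : κ → Finset β) (vc : ι → Finset β) (reg : P → Finset β)

/-- **The located family of the remainder components of a term**: each remainder component `X_r` with its
observables and its cubes (*"each one covers at least one X_{σ_1}, the support of one of the observables"*).
[cite: BalabanImbrieJaffe1988, §5.14 p.312] -/
def rloc (t : WTerm S κ ι P) : Multiset (Finset κ × Finset β) := t.groups.map fun X => (X.lab, cubes oc vc reg X)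

/-- The uncovered cubes of a located family: `Σ_r #(X_r ∖ ⋃_{j ∈ obs of X_r} oc j)` (print's exponent of the small
factor per cube). [cite: BalabanImbrieJaffe1988, §5.14 p.312] -/
def nfreeOf (𝒳 : Multiset (Finset κ × Finset β)) : ℕ := (𝒳.map fun LX => (LX.2 \ LX.1.biUnion oc).card).sum

variable {oc vc reg}

omit [Fintype S] [Fintype ι] [LinearOrder κ] [Fintype P] in
/-- A located family has one member per remainder component. [cite: BalabanImbrieJaffe1988, §5.14 p.312] -/
theorem card_rloc (t : WTerm S κ ι P) : Multiset.card (rloc oc vc reg t) = Multiset.card t.groups := by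
  rw [rloc, Multiset.card_map]

omit [Fintype S] [Fintype ι] [LinearOrder κ] [Fintype P] in
/-- The uncovered cubes of the located family of a term are those of its remainder components.
[cite: BalabanImbrieJaffe1988, §5.14 p.312] -/
theorem nfreeOf_rloc (t : WTerm S κ ι P) :
    nfreeOf oc (rloc oc vc reg t) = (t.groups.map fun X => (cubes oc vc reg X \ X.lab.biUnion oc).card).sum := by
  rw [nfreeOf, rloc, Multiset.map_map]
  rfl

variable (oc vc reg)

/-- **The remainder part localized at a located family** (*"Summing all terms in X_r gives an observable
F_{k,rem}(X_r)"*, under the integral, for the family `{X_r}` at once): the value of the terms of `expand done O` with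
no block whose located family of remainder components is `𝒳`. [cite: BalabanImbrieJaffe1988, §5.14 p.312] -/
def remAt (D : List (S → ℝ)) (done : Multiset (WGrp S κ ι P)) (O : Finset κ) (𝒳 : Multiset (Finset κ × Finset β)) : ℝ :=
  ((expand Cov trig f c legs obs M done O).map fun t =>
    if t.consts = 0 ∧ rloc oc vc reg t = 𝒳 then tval A f c legs χ D t else 0).sum

variable {A Cov trig f c legs obs M χ oc vc reg}

/-- **Localizing loses nothing**: summed over any finite set of located families containing those of the terms, the
localized remainder parts give back `remv`. [cite: BalabanImbrieJaffe1988, §5.14 p.312] -/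
theorem sum_remAt_eq_remv (D : List (S → ℝ)) (done : Multiset (WGrp S κ ι P)) (O : Finset κ)
    (𝔉 : Finset (Multiset (Finset κ × Finset β)))
    (h𝔉 : ∀ t ∈ expand Cov trig f c legs obs M done O, t.consts = 0 → rloc oc vc reg t ∈ 𝔉) :
    ∑ 𝒳 ∈ 𝔉, remAt A Cov trig f c legs obs M χ oc vc reg D done O 𝒳 = remv A Cov trig f c legs obs M χ D done O := by
  simp only [remAt]
  rw [← sum_map_finset_sum_comm, remv, ← sum_map_ite]
  refine congrArg _ (Multiset.map_congr rfl fun t ht => ?_)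
  by_cases hc : t.consts = 0
  · have e : ∀ 𝒳 ∈ 𝔉, (if t.consts = 0 ∧ rloc oc vc reg t = 𝒳 then tval A f c legs χ D t else 0)
        = if rloc oc vc reg t = 𝒳 then tval A f c legs χ D t else 0 := fun 𝒳 _ => by
      by_cases hX : rloc oc vc reg t = 𝒳
      · rw [if_pos ⟨hc, hX⟩, if_pos hX]
      · rw [if_neg fun h => hX h.2, if_neg hX]
    rw [Finset.sum_congr rfl e, Finset.sum_ite_eq, if_pos (h𝔉 t ht hc), if_pos hc]
  · rw [if_neg hc]
    exact Finset.sum_eq_zero fun 𝒳 _ => if_neg fun h => hc h.1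

end Defs

/-! ## §2  On the law of the fields of the §5.13 model: the bound with all the small factors -/

section Law

variable {α I : Type} [Fintype α] [DecidableEq α] [Fintype I] [DecidableEq I]
  {blk : α → I} {Δ : Matrix α α ℝ} {ℱ : α → ℝ} {W : Finset I}

/-- `Π_{z ∈ D} (η·‖z‖) = η^{|D|}·Π_{z ∈ D}‖z‖` (bookkeeping). [folklore] -/
private theorem prod_map_const_mul' (η : ℝ) : ∀ D : List (S → ℝ),
    (D.map fun z => η * ‖z‖).prod = η ^ D.length * (D.map fun z => ‖z‖).prod
  | [] => by simp
  | z :: D => by rw [List.map_cons, List.prod_cons, List.map_cons, List.prod_cons, prod_map_const_mul' η D,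
      List.length_cons, pow_succ]; ring

/-- **THE LOCALIZED REMAINDER PART ON THE LAW**: with the covariance split `Σ_p Cov p = (prec)⁻¹`,
`remAt(O,𝒳)/Z = Σ_{t ∈ expand 0 O, no block, rloc t = 𝒳} coef_t · 𝔼_W[Π_{pending legs of t's X_r}Φ·(Π_{dirs t}∂)χ·e^{−V}]`,
`Z = ∫ weight·source`. [cite: BalabanImbrieJaffe1988, §5.14 p.312] -/
theorem remAt_div_eq_sum_fieldLaw (hPD : (prec blk Δ W (corner ℝ W)).PosDef)
    (Cov : P → Matrix {x : α // blk x ∈ W} {x : α // blk x ∈ W} ℝ) (trig : P → Bool) (c : ι → ℝ)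
    (legs : ι → List ({x : α // blk x ∈ W} → ℝ)) (obs : κ → List ({x : α // blk x ∈ W} → ℝ)) (M : ℕ)
    (χ : ({x : α // blk x ∈ W} → ℝ) → ℝ) (oc : κ → Finset β) (vc : ι → Finset β) (reg : P → Finset β) (O : Finset κ)
    (𝒳 : Multiset (Finset κ × Finset β)) :
    remAt (prec blk Δ W (corner ℝ W)) Cov trig (src blk ℱ W) c legs obs M χ oc vc reg [] 0 O 𝒳
        / ∫ φ, weight (prec blk Δ W (corner ℝ W)) φ * source (src blk ℱ W) φ
      = ((expand Cov trig (src blk ℱ W) c legs obs M 0 O).map fun t =>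
          if t.consts = 0 ∧ rloc oc vc reg t = 𝒳 then
            t.coef * ∫ φ, ((t.groups.map fun h => (h.pend : Multiset _)).sum.map fun w => φ ⬝ᵥ w).prod
              * (dlist t.dirs χ φ * vexp c legs φ) ∂(fieldLaw blk Δ ℱ W)
          else 0).sum := by
  rw [remAt, div_eq_mul_inv, ← Multiset.sum_map_mul_right]
  refine congrArg _ (Multiset.map_congr rfl fun t _ => ?_)
  split_ifs
  · rw [tval, List.nil_append, gintM_eq_mul_integral_fieldLaw blk Δ ℱ W hPD, mul_assoc, mul_comm (∫ φ, weight _ φ * _),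
      mul_assoc, mul_inv_cancel₀ (integral_density_pos blk Δ ℱ W hPD).ne', mul_one]
  · rw [zero_mul]

/-- **THE LOCATED REMAINDER FAMILIES ARE SUMMABLE AGAINST THE INVERSE OF ALL THE SMALL FACTORS**: on the §5.13 model
with the covariance split `Σ_p Cov p = (prec)⁻¹`, under the bracket/coupling/locality hypotheses of
`BIJ88WalkRemainderSmall312.expand_l1_small_free_le` (source `src` as `f`; `θ_v, θ_w ∈ (0,1]`, `η_χ ∈ [0,1]`) and the
expectation bound `|𝔼_W[Π_{legs}Φ·(Π_{dirs t}∂)χ·e^{−V}]| ≤ K_χ·Π_{z∈dirs t}(η_χ‖z‖)·Λ` for the remainder terms of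
`expand 0 O`: for every finite set `𝔉` of located families,
`Σ_{𝒳 ∈ 𝔉} |remAt(O,𝒳)/Z| · (θ^{nfree 𝒳})⁻¹ · (s^{#𝒳})⁻¹ ≤ K_χ·Λ·W^{Φ₀(O)}·Π_{j∈O} B_ℓ^{|obs j|}`, `s = max(η_χ, θ_v^M, θ_w)`.
[cite: BalabanImbrieJaffe1988, §5.14 p.312] -/
theorem sum_abs_remAt_div_weighted_le (hPD : (prec blk Δ W (corner ℝ W)).PosDef)
    {Cov : P → Matrix {x : α // blk x ∈ W} {x : α // blk x ∈ W} ℝ} {trig : P → Bool} {c : ι → ℝ}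
    {legs : ι → List ({x : α // blk x ∈ W} → ℝ)} {obs : κ → List ({x : α // blk x ∈ W} → ℝ)} {M : ℕ}
    {χ : ({x : α // blk x ∈ W} → ℝ) → ℝ} {oc : κ → Finset β} {vc : ι → Finset β} {reg : P → Finset β}
    {Dir : Set ({x : α // blk x ∈ W} → ℝ)} {B' ρ : P → ℝ} {cV : ι → ℝ} {Bl θ θv θw ηχ ρ₀ Wc Kχ Λ : ℝ} {N₀ : ℕ}
    (hθ0 : 0 < θ) (hθ1 : θ ≤ 1) (hBl : 1 ≤ Bl) (hB0 : ∀ p, 0 ≤ B' p) (hρ : ∀ p, 0 ≤ ρ p) (hcV0 : ∀ m, 0 ≤ cV m)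
    (hη0 : 0 ≤ ηχ) (hη1 : ηχ ≤ 1) (hθv : 0 < θv) (hθv1 : θv ≤ 1) (hθw : 0 < θw) (hθw1 : θw ≤ 1)
    (hB : ∀ p, ∀ u ∈ Dir, ∀ w ∈ Dir, |(Cov p *ᵥ u) ⬝ᵥ w| ≤ B' p * ρ p)
    (hBf : ∀ p, ∀ u ∈ Dir, |(Cov p *ᵥ u) ⬝ᵥ src blk ℱ W| ≤ B' p * ρ p)
    (hBz : ∀ p, ∀ u ∈ Dir, ‖Cov p *ᵥ u‖ ≤ B' p * ρ p)
    (hcV : ∀ m, |c m| ≤ cV m) (hobs : ∀ j, ∀ w ∈ obs j, w ∈ Dir) (hlegs : ∀ m, ∀ w ∈ legs m, w ∈ Dir)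
    (hloc : ∀ p, trig p = false → B' p ≤ Bl ∧ reg p = ∅) (hwalk : ∀ p, trig p = true → B' p ≤ θw * θ ^ (reg p).card)
    (hvert : ∀ m, cV m * Bl ^ (legs m).length ≤ θv * θ ^ (vc m).card) (hρ₀0 : 0 ≤ ρ₀)
    (hρ₀ : ∀ u ∈ Dir, (∑ p ∈ univ.filter (fun p => Cov p *ᵥ u ≠ 0), ρ p) ≤ ρ₀)
    (hN : ∀ p, ∀ u ∈ Dir,
      (∑ m, ((range (legs m).length).filter fun j => (Cov p *ᵥ u) ⬝ᵥ (legs m).getD j 0 ≠ 0).card) ≤ N₀)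
    (O : Finset κ) (hW1 : 1 ≤ Wc)
    (hW : ρ₀ * ((∑ j ∈ O, ((obs j).length + 1 + M * maxArity legs) + N₀ : ℕ) : ℝ) ≤ Wc)
    (hKχ : 0 ≤ Kχ) (hΛ : 0 ≤ Λ)
    (hE : ∀ t ∈ expand Cov trig (src blk ℱ W) c legs obs M 0 O, t.consts = 0 →
      |∫ φ, ((t.groups.map fun h => (h.pend : Multiset _)).sum.map fun w => φ ⬝ᵥ w).prod
          * (dlist t.dirs χ φ * vexp c legs φ) ∂(fieldLaw blk Δ ℱ W)|
        ≤ Kχ * (t.dirs.map fun z => ηχ * ‖z‖).prod * Λ)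
    (𝔉 : Finset (Multiset (Finset κ × Finset β))) :
    ∑ 𝒳 ∈ 𝔉, |remAt (prec blk Δ W (corner ℝ W)) Cov trig (src blk ℱ W) c legs obs M χ oc vc reg [] 0 O 𝒳
          / ∫ φ, weight (prec blk Δ W (corner ℝ W)) φ * source (src blk ℱ W) φ|
        * ((θ ^ nfreeOf oc 𝒳)⁻¹ * ((max ηχ (max (θv ^ M) θw)) ^ Multiset.card 𝒳)⁻¹)
      ≤ Kχ * Λ * (Wc ^ (∑ j ∈ O, ((obs j).length + 1 + M * maxArity legs)) * ∏ j ∈ O, Bl ^ (obs j).length) := by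
  have hs0 : 0 < max ηχ (max (θv ^ M) θw) := lt_max_of_lt_right (lt_max_of_lt_right hθw)
  have hfree := expand_l1_small_free_le (oc := oc) (vc := vc) (reg := reg) hθ0 hθ1 hBl hB0 hρ hcV0 hη0 hη1 hθv hθv1
    hθw hθw1 hB hBf hBz hcV hobs hlegs hloc hwalk hvert hρ₀0 hρ₀ hN O hW1 hW
  -- shorthand for the per-term weight and the per-term normalized expectation
  set w : Multiset (Finset κ × Finset β) → ℝ := fun 𝒳 =>
    (θ ^ nfreeOf oc 𝒳)⁻¹ * ((max ηχ (max (θv ^ M) θw)) ^ Multiset.card 𝒳)⁻¹ with hw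
  have hw0 : ∀ 𝒳, 0 ≤ w 𝒳 := fun 𝒳 => mul_nonneg (inv_nonneg.2 (pow_nonneg hθ0.le _)) (inv_nonneg.2 (pow_nonneg hs0.le _))
  obtain ⟨E, hEdef⟩ : ∃ E : WTerm {x : α // blk x ∈ W} κ ι P → ℝ, ∀ t,
      E t = ∫ φ, ((t.groups.map fun h => (h.pend : Multiset _)).sum.map fun w => φ ⬝ᵥ w).prod
        * (dlist t.dirs χ φ * vexp c legs φ) ∂(fieldLaw blk Δ ℱ W) := ⟨_, fun _ => rfl⟩
  have hE' : ∀ t ∈ expand Cov trig (src blk ℱ W) c legs obs M 0 O, t.consts = 0 →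
      |E t| ≤ Kχ * (t.dirs.map fun z => ηχ * ‖z‖).prod * Λ := fun t ht hc => by
    rw [hEdef]; exact hE t ht hc
  -- each family: `|remAt/Z| ≤ Σ_{t located at 𝒳} |coef_t|·|E_t|`
  have hfam : ∀ 𝒳 ∈ 𝔉, |remAt (prec blk Δ W (corner ℝ W)) Cov trig (src blk ℱ W) c legs obs M χ oc vc reg [] 0 O 𝒳
        / ∫ φ, weight (prec blk Δ W (corner ℝ W)) φ * source (src blk ℱ W) φ| * w 𝒳
      ≤ ((expand Cov trig (src blk ℱ W) c legs obs M 0 O).map fun t =>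
          (if t.consts = 0 ∧ rloc oc vc reg t = 𝒳 then |t.coef| * |E t| else 0) * w 𝒳).sum := by
    intro 𝒳 _
    rw [remAt_div_eq_sum_fieldLaw hPD]
    refine (mul_le_mul_of_nonneg_right Multiset.abs_sum_le_sum_abs (hw0 𝒳)).trans ?_
    rw [Multiset.map_map, ← Multiset.sum_map_mul_right]
    refine Multiset.sum_map_le_sum_map _ _ fun t _ => mul_le_mul_of_nonneg_right ?_ (hw0 𝒳)
    simp only [Function.comp_apply]
    split_ifs
    · rw [abs_mul, hEdef]
    · rw [abs_zero]
  -- each term: the families it is located at sum to at most its size in units of all the small factors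
  have hterm : ∀ t ∈ expand Cov trig (src blk ℱ W) c legs obs M 0 O,
      ∑ 𝒳 ∈ 𝔉, (if t.consts = 0 ∧ rloc oc vc reg t = 𝒳 then |t.coef| * |E t| else 0) * w 𝒳
        ≤ Kχ * Λ * (|t.coef| * (t.dirs.map fun z => ‖z‖).prod * ηχ ^ t.dirs.length
          * (θ ^ ((t.consts + t.groups).map fun X => (cubes oc vc reg X \ X.lab.biUnion oc).card).sum)⁻¹
          * ((max ηχ (max (θv ^ M) θw)) ^ Multiset.card t.groups)⁻¹) := by
    intro t ht
    have hsz : 0 ≤ |t.coef| * (t.dirs.map fun z => ‖z‖).prod * ηχ ^ t.dirs.length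
        * (θ ^ ((t.consts + t.groups).map fun X => (cubes oc vc reg X \ X.lab.biUnion oc).card).sum)⁻¹
        * ((max ηχ (max (θv ^ M) θw)) ^ Multiset.card t.groups)⁻¹ :=
      mul_nonneg (mul_nonneg (mul_nonneg (mul_nonneg (abs_nonneg _) (List.prod_nonneg fun x hx => by
        obtain ⟨z, -, rfl⟩ := List.mem_map.1 hx; exact norm_nonneg z)) (pow_nonneg hη0 _))
        (inv_nonneg.2 (pow_nonneg hθ0.le _))) (inv_nonneg.2 (pow_nonneg hs0.le _))
    by_cases hc : t.consts = 0
    · have e : ∀ 𝒳 ∈ 𝔉, (if t.consts = 0 ∧ rloc oc vc reg t = 𝒳 then |t.coef| * |E t| else 0) * w 𝒳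
          = if rloc oc vc reg t = 𝒳 then |t.coef| * |E t| * w 𝒳 else 0 := fun 𝒳 _ => by
        by_cases hX : rloc oc vc reg t = 𝒳
        · rw [if_pos ⟨hc, hX⟩, if_pos hX]
        · rw [if_neg fun h => hX h.2, if_neg hX, zero_mul]
      rw [Finset.sum_congr rfl e, Finset.sum_ite_eq]
      split_ifs
      · -- the weight of the term's own family is the inverse of the term's small factors
        have hwt : w (rloc oc vc reg t)
            = (θ ^ ((t.consts + t.groups).map fun X => (cubes oc vc reg X \ X.lab.biUnion oc).card).sum)⁻¹
              * ((max ηχ (max (θv ^ M) θw)) ^ Multiset.card t.groups)⁻¹ := by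
          rw [hw]
          simp only [nfreeOf_rloc, card_rloc, hc, zero_add]
        have hEt := hE' t ht hc
        rw [prod_map_const_mul'] at hEt
        calc |t.coef| * |E t| * w (rloc oc vc reg t)
            ≤ |t.coef| * (Kχ * (ηχ ^ t.dirs.length * (t.dirs.map fun z => ‖z‖).prod) * Λ) * w (rloc oc vc reg t) :=
              mul_le_mul_of_nonneg_right (mul_le_mul_of_nonneg_left hEt (abs_nonneg _)) (hw0 _)
          _ = _ := by rw [hwt]; ring
      · exact mul_nonneg (mul_nonneg hKχ hΛ) hsz
    · rw [Finset.sum_eq_zero fun 𝒳 _ => by rw [if_neg fun h => hc h.1, zero_mul]]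
      exact mul_nonneg (mul_nonneg hKχ hΛ) hsz
  calc ∑ 𝒳 ∈ 𝔉, |remAt (prec blk Δ W (corner ℝ W)) Cov trig (src blk ℱ W) c legs obs M χ oc vc reg [] 0 O 𝒳
            / ∫ φ, weight (prec blk Δ W (corner ℝ W)) φ * source (src blk ℱ W) φ| * w 𝒳
      ≤ ∑ 𝒳 ∈ 𝔉, ((expand Cov trig (src blk ℱ W) c legs obs M 0 O).map fun t =>
          (if t.consts = 0 ∧ rloc oc vc reg t = 𝒳 then |t.coef| * |E t| else 0) * w 𝒳).sum := Finset.sum_le_sum hfam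
    _ = ((expand Cov trig (src blk ℱ W) c legs obs M 0 O).map fun t =>
          ∑ 𝒳 ∈ 𝔉, (if t.consts = 0 ∧ rloc oc vc reg t = 𝒳 then |t.coef| * |E t| else 0) * w 𝒳).sum :=
        (sum_map_finset_sum_comm _ _ _).symm
    _ ≤ ((expand Cov trig (src blk ℱ W) c legs obs M 0 O).map fun t =>
          Kχ * Λ * (|t.coef| * (t.dirs.map fun z => ‖z‖).prod * ηχ ^ t.dirs.length
            * (θ ^ ((t.consts + t.groups).map fun X => (cubes oc vc reg X \ X.lab.biUnion oc).card).sum)⁻¹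
            * ((max ηχ (max (θv ^ M) θw)) ^ Multiset.card t.groups)⁻¹)).sum := Multiset.sum_map_le_sum_map _ _ hterm
    _ = Kχ * Λ * ((expand Cov trig (src blk ℱ W) c legs obs M 0 O).map fun t =>
          |t.coef| * (t.dirs.map fun z => ‖z‖).prod * ηχ ^ t.dirs.length
            * (θ ^ ((t.consts + t.groups).map fun X => (cubes oc vc reg X \ X.lab.biUnion oc).card).sum)⁻¹
            * ((max ηχ (max (θv ^ M) θw)) ^ Multiset.card t.groups)⁻¹).sum := by rw [Multiset.sum_map_mul_left]
    _ ≤ _ := mul_le_mul_of_nonneg_left hfree (mul_nonneg hKχ hΛ)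

/-- **THE REMAINDER PART AT ONE LOCATED FAMILY: THE PRINTED THREE FACTORS AND ONE EXTRA SMALL FACTOR PER REMAINDER
COMPONENT**: under the hypotheses of `sum_abs_remAt_div_weighted_le`, for every located family `𝒳 = {(obs of X_r, X_r)}_r`,
`|remAt(O,𝒳)/Z| ≤ K_χ·Λ·W^{Φ₀(O)}·(Π_{j∈O} B_ℓ^{|obs j|})·θ^{Σ_r #(X_r ∖ obs cubes)}·s^{#𝒳}`, `s = max(η_χ, θ_v^M, θ_w)` —
large constant per observable, small factor per uncovered cube, `c(F)`, and the extra small factor of each remainder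
component (*"enough small factors to beat these large factors in the remainder terms"*).
[cite: BalabanImbrieJaffe1988, §5.14 p.312] -/
theorem abs_remAt_div_le (hPD : (prec blk Δ W (corner ℝ W)).PosDef)
    {Cov : P → Matrix {x : α // blk x ∈ W} {x : α // blk x ∈ W} ℝ} {trig : P → Bool} {c : ι → ℝ}
    {legs : ι → List ({x : α // blk x ∈ W} → ℝ)} {obs : κ → List ({x : α // blk x ∈ W} → ℝ)} {M : ℕ}
    {χ : ({x : α // blk x ∈ W} → ℝ) → ℝ} {oc : κ → Finset β} {vc : ι → Finset β} {reg : P → Finset β}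
    {Dir : Set ({x : α // blk x ∈ W} → ℝ)} {B' ρ : P → ℝ} {cV : ι → ℝ} {Bl θ θv θw ηχ ρ₀ Wc Kχ Λ : ℝ} {N₀ : ℕ}
    (hθ0 : 0 < θ) (hθ1 : θ ≤ 1) (hBl : 1 ≤ Bl) (hB0 : ∀ p, 0 ≤ B' p) (hρ : ∀ p, 0 ≤ ρ p) (hcV0 : ∀ m, 0 ≤ cV m)
    (hη0 : 0 ≤ ηχ) (hη1 : ηχ ≤ 1) (hθv : 0 < θv) (hθv1 : θv ≤ 1) (hθw : 0 < θw) (hθw1 : θw ≤ 1)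
    (hB : ∀ p, ∀ u ∈ Dir, ∀ w ∈ Dir, |(Cov p *ᵥ u) ⬝ᵥ w| ≤ B' p * ρ p)
    (hBf : ∀ p, ∀ u ∈ Dir, |(Cov p *ᵥ u) ⬝ᵥ src blk ℱ W| ≤ B' p * ρ p)
    (hBz : ∀ p, ∀ u ∈ Dir, ‖Cov p *ᵥ u‖ ≤ B' p * ρ p)
    (hcV : ∀ m, |c m| ≤ cV m) (hobs : ∀ j, ∀ w ∈ obs j, w ∈ Dir) (hlegs : ∀ m, ∀ w ∈ legs m, w ∈ Dir)
    (hloc : ∀ p, trig p = false → B' p ≤ Bl ∧ reg p = ∅) (hwalk : ∀ p, trig p = true → B' p ≤ θw * θ ^ (reg p).card)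
    (hvert : ∀ m, cV m * Bl ^ (legs m).length ≤ θv * θ ^ (vc m).card) (hρ₀0 : 0 ≤ ρ₀)
    (hρ₀ : ∀ u ∈ Dir, (∑ p ∈ univ.filter (fun p => Cov p *ᵥ u ≠ 0), ρ p) ≤ ρ₀)
    (hN : ∀ p, ∀ u ∈ Dir,
      (∑ m, ((range (legs m).length).filter fun j => (Cov p *ᵥ u) ⬝ᵥ (legs m).getD j 0 ≠ 0).card) ≤ N₀)
    (O : Finset κ) (hW1 : 1 ≤ Wc)
    (hW : ρ₀ * ((∑ j ∈ O, ((obs j).length + 1 + M * maxArity legs) + N₀ : ℕ) : ℝ) ≤ Wc)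
    (hKχ : 0 ≤ Kχ) (hΛ : 0 ≤ Λ)
    (hE : ∀ t ∈ expand Cov trig (src blk ℱ W) c legs obs M 0 O, t.consts = 0 →
      |∫ φ, ((t.groups.map fun h => (h.pend : Multiset _)).sum.map fun w => φ ⬝ᵥ w).prod
          * (dlist t.dirs χ φ * vexp c legs φ) ∂(fieldLaw blk Δ ℱ W)|
        ≤ Kχ * (t.dirs.map fun z => ηχ * ‖z‖).prod * Λ)
    (𝒳 : Multiset (Finset κ × Finset β)) :
    |remAt (prec blk Δ W (corner ℝ W)) Cov trig (src blk ℱ W) c legs obs M χ oc vc reg [] 0 O 𝒳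
        / ∫ φ, weight (prec blk Δ W (corner ℝ W)) φ * source (src blk ℱ W) φ|
      ≤ Kχ * Λ * (Wc ^ (∑ j ∈ O, ((obs j).length + 1 + M * maxArity legs)) * ∏ j ∈ O, Bl ^ (obs j).length)
        * (θ ^ nfreeOf oc 𝒳 * (max ηχ (max (θv ^ M) θw)) ^ Multiset.card 𝒳) := by
  have hs0 : 0 < max ηχ (max (θv ^ M) θw) := lt_max_of_lt_right (lt_max_of_lt_right hθw)
  have h := sum_abs_remAt_div_weighted_le (oc := oc) (vc := vc) (reg := reg) (χ := χ) hPD hθ0 hθ1 hBl hB0 hρ hcV0 hη0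
    hη1 hθv hθv1 hθw hθw1 hB hBf hBz hcV hobs hlegs hloc hwalk hvert hρ₀0 hρ₀ hN O hW1 hW hKχ hΛ hE {𝒳}
  rw [Finset.sum_singleton] at h
  have hpos : 0 < θ ^ nfreeOf oc 𝒳 * (max ηχ (max (θv ^ M) θw)) ^ Multiset.card 𝒳 :=
    mul_pos (pow_pos hθ0 _) (pow_pos hs0 _)
  rw [← mul_inv, ← div_eq_mul_inv, div_le_iff₀ hpos] at h
  exact h

end Law

end Literature.MathematicalPhysics.QuantumFieldTheory.BalabanImbrieJaffe1984to88.BIJ88WalkRemainderActivity312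

end
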